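import Summits.HodgeConjecture.HodgeConjecture.Theses.SaitoKurokawaBridge
import Literature.AlgebraicGeometry.HodgeTheory.ComplexOrientationFamily
import Literature.AlgebraicGeometry.HodgeTheory.CorrespondenceCupProductIdentities
import Literature.AlgebraicTopology.SingularHomology.CupProductProofs

/-!
# Birth skeleton — piece `SupportedBridgeClassesVanish` (item stmt-HodgeConjecture-3276; no-go lemma (A))

Two registered stubs (both KNOWN results, absent from the tree as stated) and the kernel-checked
composition `SupportedBridgeClassesVanish_of : stub₁ → stub₂ → SupportedBridgeClassesVanish`.

* `stub_gysinSpanOverProperClosed` — Deligne, Hodge III Cor. 8.2.8 with Hironaka, for the reducible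
  closed set `pr_X⁻¹(X') ⊆ Y ⊗ X`: a class dying off `pr_X⁻¹(X')` is a sum of Gysin images `g_* γ`
  from smooth projective `T → Y ⊗ X` whose image in `X` lies in `X'` (tree: the irreducible case is
  `exists_resolution_ker_restrictCompl_eq`, the reduction to irreducible supports
  `mem_iSup_ker_restrictCompl_irreducible`; what remains is `codim pr_X⁻¹(X') ≥ 1` and bookkeeping).
* `stub_pullbackVanishOfNotDominant` — a class of type `(n,0)` or `(0,n)` on the `n`-fold `X` pulls
  back to `0` along any `r : T → X` (T smooth projective) whose image lies in a proper closed `X'`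
  (Deligne, Hodge III 8.2.5: `ker (Hⁿ(X') → Hⁿ(X̃')) = W_{n-1}` for a resolution `X̃' → X'`, purity of
  `Hⁿ(X)`, and `H^{n,0}(X̃') = 0 = H^{0,n}(X̃')` as `dim X̃' < n`; tree: `IsOfHodgeType.map_eq_zero_of_lt_left`
  for `(k,0)`, conjugation for `(0,k)`).
The composition is the projection formula `g_*(g^*x ∪ γ) = x ∪ g_*γ` (`complexGysin_cup`) with
`g^*(fst*a ∪ snd*b) = (g ≫ fst)^*a ∪ (g ≫ snd)^*b = _ ∪ 0`.
-/

set_option linter.dupNamespace false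

open CategoryTheory MonoidalCategory AlgebraicGeometry
open Literature.AlgebraicGeometry Literature.AlgebraicGeometry.HodgeTheory
open Literature.AlgebraicTopology.SingularHomology

namespace Summit.HodgeConjecture.HodgeConjecture.Cruxes.ExtremeBridgeFailure.SupportedVanish

open Summit.HodgeConjecture.HodgeConjecture.Theses.SaitoKurokawaBridge
open CartesianMonoidalCategory SemiCartesianMonoidalCategory

/-- STUB 1 (Deligne 8.2.8 + Hironaka over a proper closed subset of the second factor). -/
theorem stub_gysinSpanOverProperClosed :
    ∀ (n : ℕ) (Y X : Motives.SchemeOver ℂ) (hY : Motives.IsSmoothProjective n Y)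
      (hX : Motives.IsSmoothProjective n X) (X' : Set X.left), IsClosed X' → X' ≠ Set.univ →
      ∀ κ : complexBetti (Y ⊗ X) (2 * n),
        complexBetti.restrictCompl (Y ⊗ X) ((snd Y X).left.base ⁻¹' X') (2 * n) κ = 0 →
        κ ∈ ⨆ (d : ℕ) (T : Motives.SchemeOver ℂ) (hT : Motives.IsSmoothProjective d T) (g : T ⟶ Y ⊗ X)
          (_ : Set.range (g ≫ snd Y X).left.base ⊆ X') (e : ℕ) (he : e + 2 * (n + n) = 2 * n + 2 * d),
          LinearMap.range (complexGysin complexOrientationFamily hT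
            (Motives.IsSmoothProjective.tensor_holds hY hX) g he) := by
  sorry

/-- STUB 2 (extreme Hodge types die under non-dominant pull-back). -/
theorem stub_pullbackVanishOfNotDominant :
    ∀ (n : ℕ) (X : Motives.SchemeOver ℂ) (_ : Motives.IsSmoothProjective n X) (X' : Set X.left),
      IsClosed X' → X' ≠ Set.univ →
      ∀ (d : ℕ) (T : Motives.SchemeOver ℂ) (_ : Motives.IsSmoothProjective d T) (r : T ⟶ X),
        Set.range r.left.base ⊆ X' →
        ∀ b : complexBetti X n, (IsOfHodgeType n X n n 0 b ∨ IsOfHodgeType n X n 0 n b) →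
          complexBetti.map r n b = 0 := by
  sorry

/-- COMPOSITION (kernel-checked, no sorry of its own): the two stubs give item 3276 BY NAME. -/
theorem SupportedBridgeClassesVanish_of
    (h1 : ∀ (n : ℕ) (Y X : Motives.SchemeOver ℂ) (hY : Motives.IsSmoothProjective n Y)
      (hX : Motives.IsSmoothProjective n X) (X' : Set X.left), IsClosed X' → X' ≠ Set.univ →
      ∀ κ : complexBetti (Y ⊗ X) (2 * n),
        complexBetti.restrictCompl (Y ⊗ X) ((snd Y X).left.base ⁻¹' X') (2 * n) κ = 0 →
        κ ∈ ⨆ (d : ℕ) (T : Motives.SchemeOver ℂ) (hT : Motives.IsSmoothProjective d T) (g : T ⟶ Y ⊗ X)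
          (_ : Set.range (g ≫ snd Y X).left.base ⊆ X') (e : ℕ) (he : e + 2 * (n + n) = 2 * n + 2 * d),
          LinearMap.range (complexGysin complexOrientationFamily hT
            (Motives.IsSmoothProjective.tensor_holds hY hX) g he))
    (h2 : ∀ (n : ℕ) (X : Motives.SchemeOver ℂ) (_ : Motives.IsSmoothProjective n X) (X' : Set X.left),
      IsClosed X' → X' ≠ Set.univ →
      ∀ (d : ℕ) (T : Motives.SchemeOver ℂ) (_ : Motives.IsSmoothProjective d T) (r : T ⟶ X),
        Set.range r.left.base ⊆ X' →
        ∀ b : complexBetti X n, (IsOfHodgeType n X n n 0 b ∨ IsOfHodgeType n X n 0 n b) →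
          complexBetti.map r n b = 0) :
    SupportedBridgeClassesVanish := by
  intro n Y X hY hX X' hX'c hX'u κ hκ a b hb
  have hYX := Motives.IsSmoothProjective.tensor_holds hY hX
  let L : complexBetti (Y ⊗ X) (2 * n) →ₗ[ℂ] complexBetti (Y ⊗ X) (2 * n + n + n) :=
    ((cupProduct (rfl : 2 * n + n + n = 2 * n + n + n)).flip (complexBetti.map (snd Y X) n b)) ∘ₗ
      ((cupProduct (rfl : 2 * n + n = 2 * n + n)).flip (complexBetti.map (fst Y X) n a))
  have hL : ∀ κ, L κ = cupProduct (rfl : 2 * n + n + n = 2 * n + n + n)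
      (cupProduct (rfl : 2 * n + n = 2 * n + n) κ (complexBetti.map (fst Y X) n a))
      (complexBetti.map (snd Y X) n b) := fun κ ↦ rfl
  suffices hle : (⨆ (d : ℕ) (T : Motives.SchemeOver ℂ) (hT : Motives.IsSmoothProjective d T)
      (g : T ⟶ Y ⊗ X) (_ : Set.range (g ≫ snd Y X).left.base ⊆ X') (e : ℕ)
      (he : e + 2 * (n + n) = 2 * n + 2 * d),
      LinearMap.range (complexGysin complexOrientationFamily hT hYX g he)) ≤ LinearMap.ker L by
    have := hle (h1 n Y X hY hX X' hX'c hX'u κ hκ)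
    rwa [LinearMap.mem_ker, hL] at this
  refine iSup_le fun d ↦ iSup_le fun T ↦ iSup_le fun hT ↦ iSup_le fun g ↦ iSup_le fun hg ↦
    iSup_le fun e ↦ iSup_le fun he ↦ ?_
  rintro κ ⟨γ, rfl⟩
  rw [LinearMap.mem_ker, hL]
  -- the second-factor pull-back dies
  have hb0 : complexBetti.map (g ≫ snd Y X) n b = 0 := h2 n X hX X' hX'c hX'u d T hT _ hg b hb
  have hgx : complexBetti.map g (n + n) (cupProduct (rfl : n + n = n + n)
      (complexBetti.map (fst Y X) n a) (complexBetti.map (snd Y X) n b)) = 0 := by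
    rw [complexBetti.map_cupProduct, ← complexBetti.map_comp_apply', ← complexBetti.map_comp_apply',
      hb0, map_zero]
  -- reassociate, flip, projection formula
  rw [cupProduct_assoc (rfl : 2 * n + n = 2 * n + n) (rfl : n + n = n + n) rfl
      (show 2 * n + (n + n) = 2 * n + n + n by omega),
    cupProduct_gradedComm_holds ℂ _ (show 2 * n + (n + n) = 2 * n + n + n by omega)
      (show (n + n) + 2 * n = 2 * n + n + n by omega),
    ← complexGysin_cup hasPoincareDuality_complexOrientationFamily hT hYX g
      (hpq := (rfl : (n + n) + e = n + n + e))
      (hab := (show (n + n + e) + 2 * (n + n) = (2 * n + n + n) + 2 * d by omega))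
      (hq := he) (hpq' := (show (n + n) + 2 * n = 2 * n + n + n by omega)),
    hgx, LinearMap.map_zero₂, map_zero, smul_zero]

end Summit.HodgeConjecture.HodgeConjecture.Cruxes.ExtremeBridgeFailure.SupportedVanish
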